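import Summits.BirchSwinnertonDyer.Rank1Residual.JET.HeegnerE0ReceptacleByName
import HarnessLib

/-!
# Route `KatoDescentPotSupersingular` (rung K9, cell `bsd-potss`): cruxes `WildJetchevBoundAtP` (19941, `q = p`) and
# `JetchevIrreducibleReadingByName` (20165, shared with K8-t′) — the END FORMs' receptacle binder `hGZ` BY NAME ON THE
# IRREDUCIBLE ROWS, from the image-free Literature fact `Gross1991_heegnerPoint_sub_ratTorsion_mem_E0_imageFree`
# (Gross 1991 §6 p. 245 / [GZ86, III (3.1)] read WITHOUT Gross's §2 standing hypotheses; tree p544901)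

HONEST FRAMING. Theorems only; route-free; seat `bsd-potss-k9-c4` g10; `--supports 19941`, helper. Nothing here is a
new fact, nothing is booked, no item is closed, BSD is not proved by any of this. WHAT THIS IS. The irreducible-row END
FORMs of the two cruxes (`WildJetchevBoundAtPNamedPrintOnly.thm63AtP_of_poitouTate_of_GZ31`, p541256, and
`JetchevIrreducibleReadingThm52NamedPrintOnly.h63IRowObjectsAddv_of_poitouTate_of_GZ31`, p541990; k8t-c4 g11's
`…PB2` twins keyed on `h47P2`) carry ONE closed cite-only binder, `hGZ` — "after an integer multiple `n'` prime to `p`,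
the Heegner points `γ y_m`, `γ y_{m/ℓ}` land in the receptacle `E⁰(K̄_v)` at every bad place `v` of `E/K`" — in the
guarded shape of cell `bsd-jet`'s reader (`HGZKolyvagin`: square-free `m` with Zhang–Kolyvagin prime factors) but on
rows where `ρ̄_{E,p}` is irreducible and NOT onto. Cell `bsd-jet`'s by-name supply `JET.hGZ_of_Gross1991` (seat
`bsd-jet-ty` g8, `JET/HeegnerE0ReceptacleByName.lean`) feeds that binder from the Literature fact
`Gross1991_heegnerPoint_sub_ratTorsion_mem_E0`, which is typed under Gross's §2 standing hypotheses («`E` without CM»,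
«`ℚ(E_p)` has Galois group `GL₂(ℤ/p)`») and therefore does NOT apply to the irreducible non-surjective rows. The
predecessor seat (k9-c4 g9) typed the same sentence image-free, `Gross1991_heegnerPoint_sub_ratTorsion_mem_E0_imageFree`
(its justification, [GZ86 III (3.1)] + Néron functoriality of `φ_*`, uses neither hypothesis; scope = W. Zhang's
Kolyvagin conductors). THIS FILE is bsd-jet ty g8's transport (steps V/R/H of their T4 plan) run on the image-free fact:
* `hGZ_of_Gross1991_imageFree_of_not_dvd_torsionOrder` — the END at one frame: for `W/ℚ` globally minimal of conductor
  `N`, `K` imaginary quadratic with `d_K ≠ −3, −4` and the Heegner hypothesis, `p` an odd prime with `p ∤ #E(ℚ)_tors`,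
  GRANTED the fact: `n' := #E(ℚ)_tors` is prime to `p` and, for every square-free `m` with Zhang–Kolyvagin prime
  factors, every datum `dm` of level `m`, every `γ ∈ Aut_ℚ(K[m])` and every bad place `v` of `E/K`,
  `n' • (γ y_m)_v ∈ E⁰(K̄_v)` and `n' • (γ y_{m/ℓ})_v ∈ E⁰(K̄_v)` (`ℓ ∣ m`, datum `dm'` read in `K[m]`) — from the fact's
  corollary `….nsmul_of_forall_torsion` and bsd-jet's two transport lemmas
  `JET.pointsMap_map_mem_E0Receptacle_of_forall_place` (E₀(K[m])_w for all `w ∋ N` → receptacle along any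
  `ℚ`-embedding `K[m] → K̄`) and `JET.conductorNorm_mem_and_isMinimal_of_not_hasGoodReductionAt` (bad `v` ⇒ `N ∈ v`
  and `W ⊗ K_v` minimal);
* `hGZ_of_Gross1991_imageFree` — the same with `p ∤ #E(ℚ)_tors` fed by `E[p]` irreducible (a rational point of order
  `p` spans a `Γ_ℚ`-stable line; tree `not_hasIrreducibleModPGaloisRep_of_dvd_torsionOrder`) — the frame of the
  irreducible END FORMs;
* `forall_hGZ_of_Gross1991_imageFree` — the CLOSED schema: the `hGZ` binder of p541256 / p541990 / PB2 with the
  printed guards `d_K ≠ −3`, `d_K ≠ −4` INSERTED after the Heegner-field binder (the fact carries them, Gross §1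
  p. 235; the END FORMs call `hGZ` at frames where `hD3`, `hD4` are in scope, so the guarded schema serves them
  verbatim — sequel files `…WildJetchevBoundAtPGross1991`, `…JetchevIrreducibleReadingThm52Gross1991`).
The hypothesis `γ ∈ 𝒢_m` of the binder is not used (as in bsd-jet's file).

References: [cite: GrossLMS1991, §6, proof of Prop. 6.2 (1), p. 245; §1 p. 235; §3 (3.1) p. 239]
[cite: GrossZagier1986Heegner, III (3.1) Proposition, p. 256] [cite: WZhang2014, Notations (xii)]
[cite: SilvermanAEC2009, VII.1 Prop. 1.3 (b), VII.2 Prop. 2.1, VII.5 Prop. 5.1 (a), VIII.7]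
[cite: Mazur1977, Ch. III §5, p. 157].

presearch (D-0021): `lean search 'imageFree|hGZ_of_Gross1991'` → the fact + corollaries (Literature, p544901) and
bsd-jet's surjective-scoped supplies `JET.hGZ_of_Gross1991` / `JET.forall_hGZ_of_Gross1991` only; no irreducible-row
supply in the tree. Corpus/galaxy: not needed (pure transport of a typed fact; sources as in p544901).
-/

set_option autoImplicit false
-- the Theorems directory repeats the summit name (sibling precedent `KatoDescentPotSupersingularAssembly.lean`)
set_option linter.dupNamespace false

noncomputable section

open scoped Classical Pointwise NNReal

open WeierstrassCurve IsDedekindDomain NumberField Field Literature.NumberTheory.EllipticCurves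
  Literature.NumberTheory.EllipticCurves.ModularForms
  Literature.NumberTheory.GaloisRepresentations
  Summit.BirchSwinnertonDyer.Rank1Residual.X11b Literature.NumberTheory.Automorphic
  Summit.BirchSwinnertonDyer.Rank1Residual.JET

namespace Summit.BirchSwinnertonDyer.BirchSwinnertonDyer.Theorems.HeegnerE0ImageFree

/-- **The END FORMs' receptacle binder `hGZ` at one frame, image-free, from Gross 1991 §6 / [GZ86, III (3.1)]**
(witness `n' = #E(ℚ)_tors`). For `W/ℚ` a global minimal model of conductor `N`, `K` imaginary quadratic with
`d_K ≠ −3, −4` in which every prime dividing `N` splits, `p` an odd prime NOT dividing `#E(ℚ)_tors`, a modular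
parametrisation `Dt` of level `N`, `β`, `ι : K → ℂ`: GRANTED the fact `Gross1991_heegnerPoint_sub_ratTorsion_mem_E0_imageFree`,
`n' := #E(ℚ)_tors` is prime to `p`, and for every square-free `m` all of whose prime factors are Zhang–Kolyvagin primes
for `p`, every Kolyvagin–Heegner datum `dm` of level `m`, every `γ ∈ Aut_ℚ(K[m])` and every finite place `v` of `K` of
bad reduction for `E/K`: `n' • (γ y_m)_v ∈ E⁰(K̄_v)` and, for every prime `ℓ ∣ m` and datum `dm'` of level `m/ℓ` read in
`K[m] ⊇ K[m/ℓ]`, `n' • (γ y_{m/ℓ})_v ∈ E⁰(K̄_v)` — Gross, p. 245: "for any place `w` dividing `v` in `K_n` … `y_n` is,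
up to translation by rational torsion on `E`, in `E⁰`". No hypothesis on the image of `ρ̄_{E,p}` and none on CM.
[cite: GrossLMS1991, §6, proof of Prop. 6.2 (1), p. 245; §3 (3.1) p. 239]
[cite: GrossZagier1986Heegner, III (3.1) Proposition, p. 256]
[cite: SilvermanAEC2009, VII.1 Prop. 1.3 (b), VII.2 Prop. 2.1, VII.5 Prop. 5.1 (a), VIII.7] -/
theorem hGZ_of_Gross1991_imageFree_of_not_dvd_torsionOrder
    (hF1 : Gross1991_heegnerPoint_sub_ratTorsion_mem_E0_imageFree)
    (W : WeierstrassCurve ℚ) [W.IsElliptic] [W.IsGloballyMinimal] [NeZero (W.conductorNorm ℤ)]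
    (K : Type) [Field K] [NumberField K] (hK : IsImaginaryQuadratic K)
    (hD3 : NumberField.discr K ≠ -3) (hD4 : NumberField.discr K ≠ -4)
    (hH : SatisfiesHeegnerHypothesis (W.conductorNorm ℤ) K) (p : ℕ) [Fact p.Prime] (hp2 : p ≠ 2)
    (hpt : ¬ p ∣ W.torsionOrder)
    (Dt : ModularParametrizationData W (W.conductorNorm ℤ)) (β : ℤ) (ι : K →+* ℂ)
    [∀ j : ℕ, NumberField (ringClassField K ι j)] :
    ∃ n' : ℤ, IsCoprime (p : ℤ) n' ∧ ∀ (m : ℕ), Squarefree m →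
      (∀ q ∈ m.primeFactors, Zhang2014.IsKolyvaginPrime (W.conductorNorm ℤ) W K p q) →
      ∀ (dm : KolyvaginHeegnerData Dt β ι m)
        (γ : ringClassField K ι m ≃ₐ[ℚ] ringClassField K ι m), γ ∈ ringClassGal ι m →
        ∀ v : HeightOneSpectrum (𝓞 K), ¬ (W.baseChange K).HasGoodReductionAt v →
          n' • pointsMap (W.baseChange K) (v.adicCompletion K)
              (dm.toGeomPoints (pointGalHom W (ringClassField K ι m) γ dm.y)) ∈
            E0Receptacle (W.baseChange K) v ∧
          ∀ (ℓ : ℕ), ℓ ∈ m.primeFactors → ∀ (dm' : KolyvaginHeegnerData Dt β ι (m / ℓ))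
            (hle : ringClassField K ι (m / ℓ) ≤ ringClassField K ι m),
            n' • pointsMap (W.baseChange K) (v.adicCompletion K)
                (dm.toGeomPoints (pointGalHom W (ringClassField K ι m) γ
                  (WeierstrassCurve.Affine.Point.map (W' := W)
                    ((RingClassField.inclusion ι hle).restrictScalars ℚ) dm'.y))) ∈
              E0Receptacle (W.baseChange K) v := by
  have hp : p.Prime := Fact.out
  refine ⟨(W.torsionOrder : ℤ), ?_, ?_⟩
  · exact Nat.isCoprime_iff_coprime.mpr ((Nat.Prime.coprime_iff_not_dvd hp).mpr hpt)
  have htors : ∀ t : W.toAffine.Point, IsOfFinAddOrder t → W.torsionOrder • t = 0 := fun t ht ↦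
    addOrderOf_dvd_iff_nsmul_eq_zero.mp (addOrderOf_dvd_torsionOrder W ht)
  intro m hm hKolZ dm γ _ v hv
  obtain ⟨hNv, hmin⟩ := conductorNorm_mem_and_isMinimal_of_not_hasGoodReductionAt W hK hH hv
  refine ⟨?_, fun ℓ hℓ dm' hle ↦ ?_⟩
  · -- level `m`, datum `dm`
    have hE0 : ∀ w : HeightOneSpectrum (𝓞 (ringClassField K ι m)),
        ((W.conductorNorm ℤ : ℕ) : 𝓞 (ringClassField K ι m)) ∈ w.asIdeal →
        (placeIntModel W (ringClassField K ι m) w).HasNonsingularReduction (K := ringClassField K ι m)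
          (W.torsionOrder • dm.y) := fun w hw ↦
      hF1.nsmul_of_forall_torsion hK ⟨hD3, hD4⟩ hH hp hp2 hm hKolZ dm htors w hw
    rw [← map_zsmul (pointsMap (W.baseChange K) (v.adicCompletion K)), ← map_zsmul dm.toGeomPoints,
      ← map_zsmul (pointGalHom W (ringClassField K ι m) γ), natCast_zsmul, pointGalHom_apply]
    change pointsMap (W.baseChange K) (v.adicCompletion K)
      (Affine.Point.map (W' := W) dm.emb.toRatAlgHom
        (Affine.Point.map (W' := W) (γ : ringClassField K ι m →ₐ[ℚ] ringClassField K ι m)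
          (W.torsionOrder • dm.y))) ∈ _
    rw [Affine.Point.map_map]
    exact pointsMap_map_mem_E0Receptacle_of_forall_place W v hmin hNv _ _ hE0
  · -- level `m / ℓ`, datum `dm'` read in `K[m]`
    have hmℓ : m / ℓ ∣ m := Nat.div_dvd_of_dvd (Nat.dvd_of_mem_primeFactors hℓ)
    have hE0 : ∀ w : HeightOneSpectrum (𝓞 (ringClassField K ι (m / ℓ))),
        ((W.conductorNorm ℤ : ℕ) : 𝓞 (ringClassField K ι (m / ℓ))) ∈ w.asIdeal →
        (placeIntModel W (ringClassField K ι (m / ℓ)) w).HasNonsingularReduction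
          (K := ringClassField K ι (m / ℓ)) (W.torsionOrder • dm'.y) := fun w hw ↦
      hF1.nsmul_of_forall_torsion hK ⟨hD3, hD4⟩ hH hp hp2 (hm.squarefree_of_dvd hmℓ)
        (fun q hq ↦ hKolZ q (Nat.primeFactors_mono hmℓ hm.ne_zero hq)) dm' htors w hw
    rw [← map_zsmul (pointsMap (W.baseChange K) (v.adicCompletion K)), ← map_zsmul dm.toGeomPoints,
      ← map_zsmul (pointGalHom W (ringClassField K ι m) γ),
      ← map_zsmul (Affine.Point.map (W' := W) ((RingClassField.inclusion ι hle).restrictScalars ℚ)),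
      natCast_zsmul, pointGalHom_apply]
    change pointsMap (W.baseChange K) (v.adicCompletion K)
      (Affine.Point.map (W' := W) dm.emb.toRatAlgHom
        (Affine.Point.map (W' := W) (γ : ringClassField K ι m →ₐ[ℚ] ringClassField K ι m)
          (Affine.Point.map (W' := W) ((RingClassField.inclusion ι hle).restrictScalars ℚ)
            (W.torsionOrder • dm'.y)))) ∈ _
    rw [Affine.Point.map_map, Affine.Point.map_map]
    exact pointsMap_map_mem_E0Receptacle_of_forall_place W v hmin hNv _ _ hE0

/-- **The irreducible-row frame: `hGZ` at one frame, image-free, with `p ∤ #E(ℚ)_tors` fed by `E[p]` irreducible**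
(a rational point of order `p` spans a `Γ_ℚ`-stable line, so `E[p]` irreducible forces `E(ℚ)[p] = 0`; Gross, p. 245:
"Since `E(ℚ)_p = 0` by assumption, the points `y_n` … lie in a subgroup `E′` whose image in `Φ` has order prime to `p`").
Same conclusion as `hGZ_of_Gross1991_imageFree_of_not_dvd_torsionOrder`. [cite: GrossLMS1991, §6, proof of Prop. 6.2 (1), p. 245]
[cite: GrossZagier1986Heegner, III (3.1) Proposition, p. 256] [cite: Mazur1977, Ch. III §5, p. 157] -/
theorem hGZ_of_Gross1991_imageFree
    (hF1 : Gross1991_heegnerPoint_sub_ratTorsion_mem_E0_imageFree)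
    (W : WeierstrassCurve ℚ) [W.IsElliptic] [W.IsGloballyMinimal] [NeZero (W.conductorNorm ℤ)]
    (K : Type) [Field K] [NumberField K] (hK : IsImaginaryQuadratic K)
    (hD3 : NumberField.discr K ≠ -3) (hD4 : NumberField.discr K ≠ -4)
    (hH : SatisfiesHeegnerHypothesis (W.conductorNorm ℤ) K) (p : ℕ) [Fact p.Prime] (hp2 : p ≠ 2)
    (hirr : W.HasIrreducibleModPGaloisRep p)
    (Dt : ModularParametrizationData W (W.conductorNorm ℤ)) (β : ℤ) (ι : K →+* ℂ)
    [∀ j : ℕ, NumberField (ringClassField K ι j)] :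
    ∃ n' : ℤ, IsCoprime (p : ℤ) n' ∧ ∀ (m : ℕ), Squarefree m →
      (∀ q ∈ m.primeFactors, Zhang2014.IsKolyvaginPrime (W.conductorNorm ℤ) W K p q) →
      ∀ (dm : KolyvaginHeegnerData Dt β ι m)
        (γ : ringClassField K ι m ≃ₐ[ℚ] ringClassField K ι m), γ ∈ ringClassGal ι m →
        ∀ v : HeightOneSpectrum (𝓞 K), ¬ (W.baseChange K).HasGoodReductionAt v →
          n' • pointsMap (W.baseChange K) (v.adicCompletion K)
              (dm.toGeomPoints (pointGalHom W (ringClassField K ι m) γ dm.y)) ∈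
            E0Receptacle (W.baseChange K) v ∧
          ∀ (ℓ : ℕ), ℓ ∈ m.primeFactors → ∀ (dm' : KolyvaginHeegnerData Dt β ι (m / ℓ))
            (hle : ringClassField K ι (m / ℓ) ≤ ringClassField K ι m),
            n' • pointsMap (W.baseChange K) (v.adicCompletion K)
                (dm.toGeomPoints (pointGalHom W (ringClassField K ι m) γ
                  (WeierstrassCurve.Affine.Point.map (W' := W)
                    ((RingClassField.inclusion ι hle).restrictScalars ℚ) dm'.y))) ∈
              E0Receptacle (W.baseChange K) v :=
  hGZ_of_Gross1991_imageFree_of_not_dvd_torsionOrder hF1 W K hK hD3 hD4 hH p hp2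
    (fun h ↦ not_hasIrreducibleModPGaloisRep_of_dvd_torsionOrder W p h hirr) Dt β ι

/-- **The CLOSED guarded schema `hGZ` of the irreducible END FORMs, BY NAME** — the `hGZ` binder of
`WildJetchevBoundAtPNamedPrintOnly.thm63AtP_of_poitouTate_of_GZ31` (p541256) /
`JetchevIrreducibleReadingThm52NamedPrintOnly.h63IRowObjectsAddv_of_poitouTate_of_GZ31` (p541990) / their PB2 twins,
with the printed guards `d_K ≠ −3`, `d_K ≠ −4` (Gross 1991 §1, p. 235) inserted after the Heegner-field binder, for ALL
`W`, `K`, odd `p` with `E[p]` irreducible, `Dt`, `β`, `ι` — GRANTED the image-free fact.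
[cite: GrossLMS1991, §6, proof of Prop. 6.2 (1), p. 245; §1 p. 235; §3 (3.1) p. 239]
[cite: GrossZagier1986Heegner, III (3.1) Proposition, p. 256] -/
theorem forall_hGZ_of_Gross1991_imageFree
    (hF1 : Gross1991_heegnerPoint_sub_ratTorsion_mem_E0_imageFree) :
    ∀ (W : WeierstrassCurve ℚ) [W.IsElliptic] [W.IsGloballyMinimal] [NeZero (W.conductorNorm ℤ)]
      (K : Type) [Field K] [NumberField K], IsImaginaryQuadratic K →
      NumberField.discr K ≠ -3 → NumberField.discr K ≠ -4 →
      SatisfiesHeegnerHypothesis (W.conductorNorm ℤ) K →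
      ∀ (p : ℕ) [Fact p.Prime], p ≠ 2 → W.HasIrreducibleModPGaloisRep p →
      ∀ (Dt : ModularParametrizationData W (W.conductorNorm ℤ)) (β : ℤ) (ι : K →+* ℂ)
      [∀ j : ℕ, NumberField (ringClassField K ι j)],
      ∃ n' : ℤ, IsCoprime (p : ℤ) n' ∧ ∀ (m : ℕ), Squarefree m →
        (∀ q ∈ m.primeFactors, Zhang2014.IsKolyvaginPrime (W.conductorNorm ℤ) W K p q) →
        ∀ (dm : KolyvaginHeegnerData Dt β ι m)
        (γ : ringClassField K ι m ≃ₐ[ℚ] ringClassField K ι m), γ ∈ ringClassGal ι m →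
        ∀ v : HeightOneSpectrum (𝓞 K), ¬ (W.baseChange K).HasGoodReductionAt v →
          n' • pointsMap (W.baseChange K) (v.adicCompletion K)
              (dm.toGeomPoints (pointGalHom W (ringClassField K ι m) γ dm.y)) ∈
            E0Receptacle (W.baseChange K) v ∧
          ∀ (ℓ : ℕ), ℓ ∈ m.primeFactors → ∀ (dm' : KolyvaginHeegnerData Dt β ι (m / ℓ))
            (hle : ringClassField K ι (m / ℓ) ≤ ringClassField K ι m),
            n' • pointsMap (W.baseChange K) (v.adicCompletion K)
                (dm.toGeomPoints (pointGalHom W (ringClassField K ι m) γ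
                  (WeierstrassCurve.Affine.Point.map (W' := W)
                    ((RingClassField.inclusion ι hle).restrictScalars ℚ) dm'.y))) ∈
              E0Receptacle (W.baseChange K) v :=
  fun W _ _ _ K _ _ hK hD3 hD4 hH p _ hp2 hirr Dt β ι _ ↦
    hGZ_of_Gross1991_imageFree hF1 W K hK hD3 hD4 hH p hp2 hirr Dt β ι

end Summit.BirchSwinnertonDyer.BirchSwinnertonDyer.Theorems.HeegnerE0ImageFree

end
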